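import Mathlib
import HarnessLib
import Summits.ResolutionOfSingularities.ResolutionOfSingularities.Theorems.WildQuotientsWildQuotientResolutionConductorOneDefs
import Summits.ResolutionOfSingularities.ResolutionOfSingularities.Theorems.WildQuotientsWildQuotientResolutionConductorOneChartDefs
import Summits.ResolutionOfSingularities.ResolutionOfSingularities.Theorems.WildQuotientsWildQuotientResolutionConductorOneUnitFactors

/-!
# S2 brick F3c-1 — the FRAME of the conductor-𝟙 core: the chart map `β_I : Aₙ → M_I = k[s,c,e][h_M⁻¹]`

(crux stmt-ResolutionOfSingularities-15640 `WildQuotients.WildQuotientResolution`, line `Sketch`; chain w45c post-V5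
programme S2, design `L/res-L1-w45c-lead-1/S2-DESIGN.md` §1 / §7 (7.1) («straightened coordinates `s = uᵢ`,
`c_l = (1 − t_l)/t_l` (`l ∈ I∖i`), `e_l = t_l/(1 − t_l)` (`l ∉ I`), `t_l = u_l/uᵢ`»); res-L1-w45c-plan-1 RULING
2026-08-27T18:23:36Z / NO OBJECTION 18:26:16Z (F3c). [OURS · L1 W4.5c] — NOT a statement of any manuscript; replaces
the role of no printed item; AI-produced, weaker than expert review. Def-free, witness/law form. Prover res-D-pv-033.)

The composite `Aₙ = k[u][Dₙ⁻¹] → Γ(V[uᵢ]) → Γ(O_I) ≅ M_I` on coordinates: `uᵢ ↦ s`, `u_l ↦ s·t_l` with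
`t_l = 1/(1 + c_l)` for `l ∈ I∖i` and `t_l = e_l/(1 + e_l)` for `l ∉ I`; it is well defined because every factor
`1 − u_l^{p−1}` of `Dₙ` becomes a unit of `M_I` (`((1+X_l)^{p−1} − s^{p−1})/(1+X_l)^{p−1}`, resp.
`((1+X_l)^{p−1} − (sX_l)^{p−1})/(1+X_l)^{p−1}`, resp. `1 − s^{p−1}` — factors of `h_M`).
* unit facts in `M_I = ChartRing k p n i I`: `isUnit_algebraMap_of_dvd_chartDen`, `isUnit_one_sub_chartX_pow`,
  `isUnit_one_add_chartX` (every `1 + X_l`; for `l = i` by `∏_{m<p}(1 + m s) = 1 − s^{p−1}`, F2″),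
  `isUnit_coreFactor_image_of_mem_erase / _of_not_mem`;
* **`exists_chartMap`** — for `i ∈ I` there is a `k`-algebra map `β : CoreRing k p n →ₐ[k] ChartRing k p n i I` with
  `β uᵢ = s`, `β u_l · (1 + X_l) = s` (`l ∈ I∖i`), `β u_l · (1 + X_l) = s·X_l` (`l ∉ I`) (laws in unit-free form),
  together with `β ∘ algebraMap k[u] = aeval (chartSubst)` on polynomials.
-/

-- single-problem summit: the doubled namespace component `ResolutionOfSingularities` is forced
set_option linter.dupNamespace false

noncomputable section

open MvPolynomial

namespace Summit.ResolutionOfSingularities.ResolutionOfSingularities.Theorems.WildQuotientResolution.ConductorOne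

variable (k : Type) [Field k] (p n : ℕ) [Fact p.Prime] [CharP k p] (i : Fin n) (I : Finset (Fin n))

/-! ## Units of the chart ring -/

omit [Fact p.Prime] [CharP k p] in
/-- A divisor of `h_M` is a unit of `M_I`. [OURS · L1 W4.5c] -/
theorem isUnit_algebraMap_of_dvd_chartDen (f : MvPolynomial (Fin n) k) (hf : f ∣ chartDen k p n i I) :
    IsUnit (algebraMap (MvPolynomial (Fin n) k) (ChartRing k p n i I) f) := by
  obtain ⟨g, hg⟩ := hf
  have h : IsUnit (algebraMap (MvPolynomial (Fin n) k) (ChartRing k p n i I) f *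
      algebraMap (MvPolynomial (Fin n) k) (ChartRing k p n i I) g) := by
    rw [← map_mul, ← hg]
    exact IsLocalization.Away.algebraMap_isUnit (chartDen k p n i I)
  exact isUnit_of_mul_isUnit_left h

omit [Fact p.Prime] [CharP k p] in
/-- `1 − s^{p−1}` is a unit of `M_I`. [OURS · L1 W4.5c] -/
theorem isUnit_one_sub_chartX_pow : IsUnit (1 - chartX k p n i I i ^ (p - 1)) := by
  have h := isUnit_algebraMap_of_dvd_chartDen k p n i I (1 - X i ^ (p - 1))
    (by unfold chartDen; exact dvd_mul_right _ _)
  simpa only [map_sub, map_one, map_pow] using h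

omit [Fact p.Prime] [CharP k p] in
/-- For `l ∈ I∖i`: `1 + X_l` and `(1 + X_l)^{p−1} − s^{p−1}` are units of `M_I`. [OURS · L1 W4.5c] -/
theorem isUnit_factors_of_mem_erase (l : Fin n) (hl : l ∈ I.erase i) :
    IsUnit (1 + chartX k p n i I l) ∧
      IsUnit ((1 + chartX k p n i I l) ^ (p - 1) - chartX k p n i I i ^ (p - 1)) := by
  have hdvd : ((1 + X l) * ((1 + X l) ^ (p - 1) - X i ^ (p - 1)) : MvPolynomial (Fin n) k) ∣
      chartDen k p n i I := by
    have h1 := Finset.dvd_prod_of_mem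
      (fun l : Fin n => ((1 + X l) * ((1 + X l) ^ (p - 1) - X i ^ (p - 1)) : MvPolynomial (Fin n) k)) hl
    unfold chartDen
    exact Dvd.dvd.mul_left (Dvd.dvd.mul_right h1 _) _
  have h := isUnit_algebraMap_of_dvd_chartDen k p n i I _ hdvd
  rw [map_mul, IsUnit.mul_iff] at h
  refine ⟨?_, ?_⟩
  · simpa only [map_add, map_one] using h.1
  · simpa only [map_sub, map_pow, map_add, map_one] using h.2

omit [Fact p.Prime] [CharP k p] in
/-- For `l ∉ I`: `1 + X_l` and `(1 + X_l)^{p−1} − (s X_l)^{p−1}` are units of `M_I`. [OURS · L1 W4.5c] -/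
theorem isUnit_factors_of_not_mem (l : Fin n) (hl : l ∉ I) :
    IsUnit (1 + chartX k p n i I l) ∧
      IsUnit ((1 + chartX k p n i I l) ^ (p - 1) - (chartX k p n i I i * chartX k p n i I l) ^ (p - 1)) := by
  have hl' : l ∈ Finset.univ \ I := Finset.mem_sdiff.mpr ⟨Finset.mem_univ l, hl⟩
  have hdvd : ((1 + X l) * ((1 + X l) ^ (p - 1) - (X i * X l) ^ (p - 1)) : MvPolynomial (Fin n) k) ∣
      chartDen k p n i I := by
    have h1 := Finset.dvd_prod_of_mem
      (fun l : Fin n => ((1 + X l) * ((1 + X l) ^ (p - 1) - (X i * X l) ^ (p - 1)) : MvPolynomial (Fin n) k)) hl'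
    unfold chartDen
    exact Dvd.dvd.mul_left (Dvd.dvd.mul_left h1 _) _
  have h := isUnit_algebraMap_of_dvd_chartDen k p n i I _ hdvd
  rw [map_mul, IsUnit.mul_iff] at h
  refine ⟨?_, ?_⟩
  · simpa only [map_add, map_one] using h.1
  · simpa only [map_sub, map_pow, map_add, map_one, map_mul] using h.2

/-- `1 + s` is a unit of `M_I` (`∏_{m=1}^{p−1} (1 + m uᵢ) = 1 − uᵢ^{p−1}` in `k[u]`, F2″, then `h_M`).
[OURS · L1 W4.5c] -/
theorem isUnit_one_add_chartX_self : IsUnit (1 + chartX k p n i I i) := by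
  have hprod := prod_one_add_natCast_mul (MvPolynomial (Fin n) k) p (X i)
  have h1 : (1 : ℕ) ∈ Finset.Ico 1 p := Finset.mem_Ico.mpr ⟨le_rfl, (Fact.out : p.Prime).one_lt⟩
  have hdvd : ((1 + X i : MvPolynomial (Fin n) k)) ∣ (1 - X i ^ (p - 1)) := by
    rw [← hprod]
    have h := Finset.dvd_prod_of_mem
      (fun m : ℕ => (1 + (m : MvPolynomial (Fin n) k) * X i)) h1
    simpa only [Nat.cast_one, one_mul] using h
  have h := isUnit_algebraMap_of_dvd_chartDen k p n i I (1 + X i)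
    (hdvd.trans (by unfold chartDen; exact dvd_mul_right _ _))
  simpa only [map_add, map_one] using h

/-- Every `1 + X_l` is a unit of `M_I` (for `i ∈ I`). [OURS · L1 W4.5c] -/
theorem isUnit_one_add_chartX (hi : i ∈ I) (l : Fin n) : IsUnit (1 + chartX k p n i I l) := by
  by_cases hli : l = i
  · subst hli; exact isUnit_one_add_chartX_self k p n l I
  by_cases hlI : l ∈ I
  · exact (isUnit_factors_of_mem_erase k p n i I l (Finset.mem_erase.mpr ⟨hli, hlI⟩)).1
  · exact (isUnit_factors_of_not_mem k p n i I l hlI).1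

/-! ## The chart map -/

/-- **The chart map `β_I : Aₙ →ₐ[k] M_I`** (`i ∈ I`): `β uᵢ = s`, `β u_l·(1+X_l) = s` for `l ∈ I∖i`,
`β u_l·(1+X_l) = s·X_l` for `l ∉ I`. [OURS · L1 W4.5c] -/
theorem exists_chartMap (hi : i ∈ I) :
    ∃ β : CoreRing k p n →ₐ[k] ChartRing k p n i I,
      β (coreU k p n i) = chartX k p n i I i ∧
      (∀ l ∈ I.erase i, β (coreU k p n l) * (1 + chartX k p n i I l) = chartX k p n i I i) ∧
      (∀ l ∉ I, β (coreU k p n l) * (1 + chartX k p n i I l) = chartX k p n i I i * chartX k p n i I l) ∧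
      (∀ l ∈ I.erase i, β (coreU k p n l) =
        chartX k p n i I i * ↑((isUnit_one_add_chartX k p n i I hi l).unit⁻¹)) ∧
      (∀ l ∉ I, β (coreU k p n l) =
        chartX k p n i I i * chartX k p n i I l * ↑((isUnit_one_add_chartX k p n i I hi l).unit⁻¹)) := by
  -- the substitution
  let v : Fin n → ChartRing k p n i I := fun l =>
    if l = i then chartX k p n i I i
    else if l ∈ I then chartX k p n i I i * ↑((isUnit_one_add_chartX k p n i I hi l).unit⁻¹)
    else chartX k p n i I i * chartX k p n i I l * ↑((isUnit_one_add_chartX k p n i I hi l).unit⁻¹)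
  let β₀ : MvPolynomial (Fin n) k →ₐ[k] ChartRing k p n i I := MvPolynomial.aeval v
  have hvi : v i = chartX k p n i I i := by simp [v]
  have hvI : ∀ l ∈ I.erase i, v l = chartX k p n i I i * ↑((isUnit_one_add_chartX k p n i I hi l).unit⁻¹) := by
    intro l hl
    obtain ⟨hli, hlI⟩ := Finset.mem_erase.mp hl
    simp [v, hli, hlI]
  have hvO : ∀ l ∉ I, v l =
      chartX k p n i I i * chartX k p n i I l * ↑((isUnit_one_add_chartX k p n i I hi l).unit⁻¹) := by
    intro l hl
    have hli : l ≠ i := fun h => hl (h ▸ hi)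
    simp [v, hli, hl]
  have hinv : ∀ l, (1 + chartX k p n i I l) * ↑((isUnit_one_add_chartX k p n i I hi l).unit⁻¹) = 1 := by
    intro l
    have h := (isUnit_one_add_chartX k p n i I hi l).unit.mul_inv
    rwa [IsUnit.unit_spec] at h
  -- `β₀ (1 − u_l^{p−1})` is a unit for every `l`
  have hfac : ∀ l, IsUnit (β₀ (1 - X l ^ (p - 1))) := by
    intro l
    have e : β₀ (1 - X l ^ (p - 1)) = 1 - v l ^ (p - 1) := by
      simp only [β₀, map_sub, map_one, map_pow, MvPolynomial.aeval_X]
    rw [e]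
    by_cases hli : l = i
    · subst hli; rw [hvi]; exact isUnit_one_sub_chartX_pow k p n l I
    by_cases hlI : l ∈ I
    · have hl : l ∈ I.erase i := Finset.mem_erase.mpr ⟨hli, hlI⟩
      rw [hvI l hl]
      -- `1 − (s w)^{p−1} = ((1+X_l)^{p−1} − s^{p−1}) · w^{p−1}`, `w = (1+X_l)⁻¹`
      have key : 1 - (chartX k p n i I i * ↑((isUnit_one_add_chartX k p n i I hi l).unit⁻¹)) ^ (p - 1) =
          ((1 + chartX k p n i I l) ^ (p - 1) - chartX k p n i I i ^ (p - 1)) *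
            (↑((isUnit_one_add_chartX k p n i I hi l).unit⁻¹)) ^ (p - 1) := by
        rw [sub_mul, ← mul_pow, ← mul_pow, hinv l, one_pow]
      rw [key]
      exact (isUnit_factors_of_mem_erase k p n i I l hl).2.mul ((Units.isUnit _).pow _)
    · rw [hvO l hlI]
      have key : 1 - (chartX k p n i I i * chartX k p n i I l *
            ↑((isUnit_one_add_chartX k p n i I hi l).unit⁻¹)) ^ (p - 1) =
          ((1 + chartX k p n i I l) ^ (p - 1) - (chartX k p n i I i * chartX k p n i I l) ^ (p - 1)) *
            (↑((isUnit_one_add_chartX k p n i I hi l).unit⁻¹)) ^ (p - 1) := by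
        rw [sub_mul, ← mul_pow, ← mul_pow, hinv l, one_pow]
      rw [key]
      exact (isUnit_factors_of_not_mem k p n i I l hlI).2.mul ((Units.isUnit _).pow _)
  have hD : IsUnit (β₀ (coreDenominator k p n)) := by
    unfold coreDenominator
    rw [map_prod]
    exact IsUnit.prod_univ_iff.mpr hfac
  -- the lift (scalar tower `k → k[u] → Aₙ` is by `rfl`)
  let β : CoreRing k p n →ₐ[k] ChartRing k p n i I :=
    IsLocalization.Away.liftAlgHom (S := CoreRing k p n) (coreDenominator k p n) (f := β₀) hD
  have hβ : ∀ l, β (coreU k p n l) = v l := by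
    intro l
    change IsLocalization.Away.lift (coreDenominator k p n) hD (algebraMap _ _ (X l)) = v l
    rw [IsLocalization.Away.lift_eq]
    exact MvPolynomial.aeval_X v l
  refine ⟨β, ?_, ?_, ?_, ?_, ?_⟩
  · rw [hβ, hvi]
  · intro l hl
    rw [hβ, hvI l hl, mul_assoc, mul_comm (↑((isUnit_one_add_chartX k p n i I hi l).unit⁻¹) : ChartRing k p n i I),
      hinv l, mul_one]
  · intro l hl
    rw [hβ, hvO l hl, mul_assoc, mul_comm (↑((isUnit_one_add_chartX k p n i I hi l).unit⁻¹) : ChartRing k p n i I),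
      hinv l, mul_one]
  · intro l hl; rw [hβ, hvI l hl]
  · intro l hl; rw [hβ, hvO l hl]

end Summit.ResolutionOfSingularities.ResolutionOfSingularities.Theorems.WildQuotientResolution.ConductorOne

end
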